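import Summits.HubbardSuperconductivity.HubbardSuperconductivity.Theorems.AnisotropyChordTransferParityFlips
import Literature.MathematicalPhysics.QuantumLattice.AnisotropicHeisenbergEnergyComparison

/-!
# Route `AnisotropyChord` / H0 rotor rung, route (1), hypothesis (H3) = THEOREM Z⁺: MATRIX ELEMENTS IN THE ROTATED FRAME

THEOREM Z⁺ (theory seat `hubbard-h0-rotor-theory-1`, THEOREM-Z.md, memo ROTOR-THEORY-11 §176) is proved in the frame in which the
easy-plane XXZ ferromagnet `H(Δ) = −Σ(SˣSˣ + SʸSʸ + ΔSᶻSᶻ)` becomes Björnberg–Ueltschi's three-coupling bond Hamiltonian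
`H'(1, Δ, 1) = −Σ(SˣSˣ + ΔSʸSʸ + SᶻSᶻ)` (tree `exists_frame_xyzBondHamiltonian₃`: `Sˣ ↦ −Sᶻ ↦ Sʸ ↦ Sˣ`), which is STOQUASTIC in the
`Sᶻ` product basis for `|Δ| ≤ 1` (tree `xyzBondHamiltonian₃_apply`).  This file computes the spin-½ matrix elements that the
flip-parity argument needs:

* spin-½ single-site entries (`spinX_one_apply`, `spinY_one_apply`, `pauliY_apply`) and the conjugation `σʸ S^b σʸ = ∓S^b`
  (`pauliY_conj_spinVec`);
* two-site products of off-diagonal single-site operators are supported on DOUBLE FLIPS (`onSite_mul_onSite_apply_offdiag`); the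
  bonds `SˣSˣ`, `SʸSʸ`, `SᶻSᶻ` and the three-coupling bond `xyzBond₃ 1 J₁ J₂ J₃` off the diagonal (`xyzBond₃_one_apply_of_ne`:
  `(J₁ ∓ J₂)/4` on the double flip, `0` elsewhere);
* on the torus: `H'(J₁,J₂,J₃)` vanishes off edge double flips (`xyzBondHamiltonian₃_one_apply_eq_zero`), equals `−(J₁ ∓ J₂)/4` on
  them (`xyzBondHamiltonian₃_one_apply_doubleFlip`), hence PRESERVES the parity of `Σ_z σ_z`
  (`xyzBondHamiltonian₃_one_apply_of_parity_ne`); real symmetric non-positive-off-diagonal entries (`xyzBondHamiltonian₃_entries`);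
* `Sʸ_tot` (spin ½) CHANGES the parity (`totalSpin_one_one_apply_of_parity_eq`).

All folklore (Tasaki 2020 §2.2; Björnberg–Ueltschi (A.3)).  Prover seat `hubbard-h0-rotor-p1` g14.
-/

set_option linter.dupNamespace false
set_option autoImplicit false

noncomputable section

open Finset Matrix
open scoped ComplexOrder
open Literature.MathematicalPhysics.QuantumLattice

namespace Summit.HubbardSuperconductivity.HubbardSuperconductivity.Theorems.AnisotropyChord.Transfer

/-! ## Spin-½ matrix elements -/

section SpinHalf

open Complex Literature.MathematicalPhysics.QuantumLattice.SpinOperators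

/-- the two elements of `Fin 2` (local copy of a two-line triviality; cf. `Literature.Probability.LatticeModels.fin_two_eq_zero_or_one`,
not imported to keep the percolation modules out of this import graph). [folklore] -/
private theorem fin2_cases (k : Fin 2) : k = 0 ∨ k = 1 := by
  fin_cases k <;> simp

/-- entries of `σʸ`. [folklore] -/
theorem pauliY_apply (k l : Fin 2) :
    spinHalfPauli 1 k l = if l = 1 - k then (if k = 0 then -I else I) else 0 := by
  fin_cases k <;> fin_cases l <;> simp [spinHalfPauli]

/-- entries of the spin-½ `Sˣ`: `½` off the diagonal. [folklore] -/
theorem spinX_one_apply (k l : Fin 2) :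
    spinX 1 k l = if l = 1 - k then (1 / 2 : ℂ) else 0 := by
  have h := spinVec_one_eq_half_spinHalfPauli 0
  rw [spinVec_zero] at h
  rw [h]
  fin_cases k <;> fin_cases l <;> simp [spinHalfPauli]

/-- entries of the spin-½ `Sʸ`: `∓i/2` off the diagonal. [folklore] -/
theorem spinY_one_apply (k l : Fin 2) :
    spinY 1 k l = if l = 1 - k then (if k = 0 then -I / 2 else I / 2) else 0 := by
  have h := spinVec_one_eq_half_spinHalfPauli 1
  rw [spinVec_one] at h
  rw [h]
  fin_cases k <;> fin_cases l <;> simp [spinHalfPauli] <;> ring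

/-- `σʸ σʸ = 1`. [folklore] -/
theorem pauliY_mul_pauliY : spinHalfPauli 1 * spinHalfPauli 1 = 1 := by
  ext i j
  fin_cases i <;> fin_cases j <;> simp [spinHalfPauli, Matrix.mul_apply, Fin.sum_univ_two]

/-- `σʸ` is Hermitian. [folklore] -/
theorem pauliY_conjTranspose : (spinHalfPauli 1)ᴴ = spinHalfPauli 1 := by
  ext i j
  fin_cases i <;> fin_cases j <;> simp [spinHalfPauli, Matrix.conjTranspose_apply]

/-- conjugation of the spin-½ spin vector by `σʸ`: `σʸ Sˣ σʸ = −Sˣ`, `σʸ Sʸ σʸ = Sʸ`, `σʸ Sᶻ σʸ = −Sᶻ` (the π-rotation about the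
`y` axis). [folklore] -/
theorem pauliY_conj_spinVec (b : Fin 3) :
    spinHalfPauli 1 * spinVec 1 b * (spinHalfPauli 1)ᴴ = (if b = 1 then (1 : ℂ) else -1) • spinVec 1 b := by
  rw [pauliY_conjTranspose, spinVec_one_eq_half_spinHalfPauli]
  fin_cases b <;>
  · ext i j
    fin_cases i <;> fin_cases j <;>
      simp [spinHalfPauli, Matrix.mul_apply, Fin.sum_univ_two] <;> ring_nf <;> simp [Complex.I_sq] <;> ring

end SpinHalf

/-! ## Two-site matrix elements of spin-½ operators: double flips -/

section TwoSite

open Complex Literature.MathematicalPhysics.QuantumLattice.SpinOperators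

variable {Λ : Type*} [Fintype Λ] [DecidableEq Λ]

/-- an element of `Fin 2` is either `1 - k` or `k`. [folklore] -/
private theorem fin2_eq_or (k l : Fin 2) : l = 1 - k ∨ l = k := by
  fin_cases k <;> fin_cases l <;> simp

omit [Fintype Λ] in
/-- characterisation of the double flip. [folklore] -/
theorem eq_flipAt_flipAt_iff {x y : Λ} (hxy : x ≠ y) (σ τ : Λ → Fin 2) :
    τ = flipAt x (flipAt y σ) ↔ τ x = 1 - σ x ∧ τ y = 1 - σ y ∧ ∀ z, z ≠ x → z ≠ y → τ z = σ z := by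
  constructor
  · rintro rfl
    refine ⟨?_, ?_, ?_⟩
    · rw [flipAt_apply_self, flipAt_apply_of_ne _ hxy]
    · rw [flipAt_apply_of_ne _ (Ne.symm hxy), flipAt_apply_self]
    · intro z hzx hzy; rw [flipAt_apply_of_ne _ hzx, flipAt_apply_of_ne _ hzy]
  · rintro ⟨hx, hy, hrest⟩
    funext z
    by_cases hzx : z = x
    · subst hzx; rw [hx, flipAt_apply_self, flipAt_apply_of_ne _ hxy]
    · by_cases hzy : z = y
      · subst hzy; rw [hy, flipAt_apply_of_ne _ hzx, flipAt_apply_self]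
      · rw [hrest z hzx hzy, flipAt_apply_of_ne _ hzx, flipAt_apply_of_ne _ hzy]

omit [Fintype Λ] in
/-- characterisation of the single flip. [folklore] -/
theorem eq_flipAt_iff {x : Λ} (σ τ : Λ → Fin 2) :
    τ = flipAt x σ ↔ τ x = 1 - σ x ∧ ∀ z, z ≠ x → τ z = σ z := by
  constructor
  · rintro rfl
    exact ⟨flipAt_apply_self x σ, fun z hz => flipAt_apply_of_ne _ hz⟩
  · rintro ⟨hx, hrest⟩
    funext z
    by_cases hzx : z = x
    · subst hzx; rw [hx, flipAt_apply_self]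
    · rw [hrest z hzx, flipAt_apply_of_ne _ hzx]

/-- **matrix elements of a product of two OFF-DIAGONAL single-site spin-½ operators at distinct sites**: non-zero only on the
double flip, `⟨σ| a_x b_y |τ⟩ = [τ = σ^{(x,y)}]·a_{σ_x, 1−σ_x} b_{σ_y, 1−σ_y}`. [folklore] -/
theorem onSite_mul_onSite_apply_offdiag {x y : Λ} (hxy : x ≠ y) (a b : Matrix (Fin 2) (Fin 2) ℂ)
    (ha : ∀ k, a k k = 0) (hb : ∀ k, b k k = 0) (σ τ : Λ → Fin 2) :
    (onSite x a * onSite y b : Op Λ 2) σ τ =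
      if τ = flipAt x (flipAt y σ) then a (σ x) (1 - σ x) * b (σ y) (1 - σ y) else 0 := by
  rw [onSite_mul_onSite_apply_prod_one hxy]
  by_cases h : τ = flipAt x (flipAt y σ)
  · rw [if_pos h]
    obtain ⟨hx, hy, hrest⟩ := (eq_flipAt_flipAt_iff hxy σ τ).1 h
    rw [hx, hy]
    have hone : (∏ z ∈ (Finset.univ.erase x).erase y, (1 : Matrix (Fin 2) (Fin 2) ℂ) (σ z) (τ z)) = 1 := by
      refine Finset.prod_eq_one fun z hz => ?_
      have hzy : z ≠ y := Finset.ne_of_mem_erase hz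
      have hzx : z ≠ x := Finset.ne_of_mem_erase (Finset.mem_of_mem_erase hz)
      rw [hrest z hzx hzy, Matrix.one_apply_eq]
    rw [hone, mul_one]
  · rw [if_neg h]
    rw [eq_flipAt_flipAt_iff hxy σ τ] at h
    push Not at h
    rcases fin2_eq_or (σ x) (τ x) with hx | hx
    · rcases fin2_eq_or (σ y) (τ y) with hy | hy
      · obtain ⟨z, hzx, hzy, hz⟩ := h hx hy
        have hmem : z ∈ (Finset.univ.erase x).erase y :=
          Finset.mem_erase.2 ⟨hzy, Finset.mem_erase.2 ⟨hzx, Finset.mem_univ z⟩⟩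
        rw [Finset.prod_eq_zero hmem (by simp [Ne.symm hz]), mul_zero]
      · rw [hy, hb, mul_zero, zero_mul]
    · rw [hx, ha, zero_mul, zero_mul]

/-- **matrix elements of an OFF-DIAGONAL single-site spin-½ operator**: non-zero only on the single flip. [folklore] -/
theorem onSite_apply_offdiag (x : Λ) (a : Matrix (Fin 2) (Fin 2) ℂ) (ha : ∀ k, a k k = 0) (σ τ : Λ → Fin 2) :
    (onSite x a : Op Λ 2) σ τ = if τ = flipAt x σ then a (σ x) (1 - σ x) else 0 := by
  rw [onSite_apply]
  by_cases h : τ = flipAt x σ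
  · rw [if_pos h]
    obtain ⟨hx, hrest⟩ := (eq_flipAt_iff σ τ).1 h
    rw [if_pos (fun z hz => (hrest z hz).symm), hx]
  · rw [if_neg h]
    rw [eq_flipAt_iff σ τ] at h
    push Not at h
    by_cases hoff : ∀ z, z ≠ x → σ z = τ z
    · rw [if_pos hoff]
      rcases fin2_eq_or (σ x) (τ x) with hx | hx
      · obtain ⟨z, hzx, hz⟩ := h hx
        exact absurd (hoff z hzx).symm hz
      · rw [hx, ha]
    · rw [if_neg hoff]

/-- the `SˣSˣ` bond of spin ½: `¼` on the double flip. [folklore] -/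
theorem spinBond_one_zero_apply {x y : Λ} (hxy : x ≠ y) (σ τ : Λ → Fin 2) :
    (spinBond 1 0 x y : Op Λ 2) σ τ = if τ = flipAt x (flipAt y σ) then (1 / 4 : ℂ) else 0 := by
  have hdiag : ∀ k : Fin 2, spinX 1 k k = 0 := fun k => by
    rw [spinX_one_apply]; rcases fin2_cases k with hk | hk <;> simp [hk]
  rw [spinBond_eq_mul_of_ne hxy, siteSpin, siteSpin, spinVec_zero, onSite_mul_onSite_apply_offdiag hxy _ _ hdiag hdiag]
  split_ifs with h
  · rw [spinX_one_apply, spinX_one_apply, if_pos rfl, if_pos rfl]; norm_num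
  · rfl

/-- the `SʸSʸ` bond of spin ½: `∓¼` on the double flip (− for parallel, + for antiparallel spins). [folklore] -/
theorem spinBond_one_one_apply {x y : Λ} (hxy : x ≠ y) (σ τ : Λ → Fin 2) :
    (spinBond 1 1 x y : Op Λ 2) σ τ =
      if τ = flipAt x (flipAt y σ) then (if σ x = σ y then -(1 / 4 : ℂ) else (1 / 4 : ℂ)) else 0 := by
  have hdiag : ∀ k : Fin 2, spinY 1 k k = 0 := fun k => by
    rw [spinY_one_apply]; rcases fin2_cases k with hk | hk <;> simp [hk]
  rw [spinBond_eq_mul_of_ne hxy, siteSpin, siteSpin, spinVec_one, onSite_mul_onSite_apply_offdiag hxy _ _ hdiag hdiag]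
  by_cases h : τ = flipAt x (flipAt y σ)
  · rw [if_pos h, if_pos h, spinY_one_apply, spinY_one_apply, if_pos rfl, if_pos rfl]
    rcases fin2_cases (σ x) with hx | hx <;> rcases fin2_cases (σ y) with hy | hy <;>
      simp [hx, hy] <;> ring_nf <;> simp [Complex.I_sq] <;> norm_num
  · rw [if_neg h, if_neg h]

/-- the `SᶻSᶻ` bond of spin ½ is diagonal. [folklore] -/
theorem spinBond_one_two_apply_of_ne {x y : Λ} (hxy : x ≠ y) {σ τ : Λ → Fin 2} (hστ : σ ≠ τ) :
    (spinBond 1 2 x y : Op Λ 2) σ τ = 0 := by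
  obtain ⟨t, ht, ht0⟩ := siteSpin_two_mul_apply 1 hxy σ τ
  rw [spinBond_eq_mul_of_ne hxy, ht, ht0 hστ, Complex.ofReal_zero]

/-- **off-diagonal matrix elements of the three-coupling spin-½ bond** `J₁ SˣSˣ + J₂ SʸSʸ + J₃ SᶻSᶻ`: non-zero only on the
double flip, where it is `(J₁ ∓ J₂)/4`. [folklore] -/
theorem xyzBond₃_one_apply_of_ne (J₁ J₂ J₃ : ℝ) {x y : Λ} (hxy : x ≠ y) {σ τ : Λ → Fin 2} (hστ : σ ≠ τ) :
    xyzBond₃ 1 J₁ J₂ J₃ x y σ τ =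
      if τ = flipAt x (flipAt y σ) then (((J₁ - (if σ x = σ y then J₂ else -J₂)) / 4 : ℝ) : ℂ) else 0 := by
  rw [xyzBond₃, Matrix.add_apply, Matrix.add_apply, Matrix.smul_apply, Matrix.smul_apply, Matrix.smul_apply,
    spinBond_one_zero_apply hxy, spinBond_one_one_apply hxy, spinBond_one_two_apply_of_ne hxy hστ]
  by_cases h : τ = flipAt x (flipAt y σ)
  · simp only [if_pos h, smul_eq_mul, mul_zero, add_zero]
    split_ifs <;> push_cast <;> ring
  · simp [if_neg h]

end TwoSite

/-! ## The rotated-frame operators: the three-coupling bond Hamiltonian `H'(J₁,J₂,J₃)` on the torus (spin ½), the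
magnetisation `Sʸ_tot`, and the flip operator `⨂σʸ` -/

section TorusEntries

open Complex Literature.MathematicalPhysics.QuantumLattice.SpinOperators Literature.Probability.LatticeModels

variable {Λ : Type*} [Fintype Λ] [DecidableEq Λ]

omit [Fintype Λ] in
/-- `k ≠ 1 - k` in `Fin 2`. [folklore] -/
private theorem fin2_ne_sub (k : Fin 2) : k ≠ 1 - k := by
  fin_cases k <;> simp

omit [Fintype Λ] in
/-- a double flip at distinct sites determines the (unordered) pair of sites. [folklore] -/
theorem sym2_eq_of_flipAt_flipAt_eq {x y x' y' : Λ} (hxy : x ≠ y) (σ : Λ → Fin 2)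
    (h : flipAt x (flipAt y σ) = flipAt x' (flipAt y' σ)) : s(x, y) = s(x', y') := by
  -- `x` and `y` are moved by the right-hand side, hence lie in `{x', y'}`
  have key : ∀ z, flipAt x (flipAt y σ) z ≠ σ z → z = x' ∨ z = y' := by
    intro z hz
    by_contra hcon
    push Not at hcon
    rw [h, flipAt_apply_of_ne _ hcon.1, flipAt_apply_of_ne _ hcon.2] at hz
    exact hz rfl
  have hx : x = x' ∨ x = y' := key x (by
    rw [flipAt_apply_self, flipAt_apply_of_ne _ hxy]; exact (fin2_ne_sub (σ x)).symm)
  have hy : y = x' ∨ y = y' := key y (by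
    rw [flipAt_apply_of_ne _ (Ne.symm hxy), flipAt_apply_self]; exact (fin2_ne_sub (σ y)).symm)
  rw [Sym2.eq_iff]
  rcases hx with rfl | rfl <;> rcases hy with h' | h'
  · exact absurd h'.symm hxy
  · exact Or.inl ⟨rfl, h'⟩
  · exact Or.inr ⟨rfl, h'⟩
  · exact absurd h'.symm hxy

variable {d : ℕ} (L : ℕ) [NeZero L]

/-- adjacency from membership in the edge set. [folklore] -/
private theorem adj_of_mem_edgeFinset {x y : TorusSite d L} (h : s(x, y) ∈ (torusGraph d L).edgeFinset) :
    (torusGraph d L).Adj x y := by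
  rwa [SimpleGraph.mem_edgeFinset, SimpleGraph.mem_edgeSet] at h

/-- **off-diagonal matrix elements of the spin-½ `H'(J₁,J₂,J₃)` vanish off the edge double flips.** [folklore] -/
theorem xyzBondHamiltonian₃_one_apply_eq_zero (J₁ J₂ J₃ : ℝ) {σ τ : TensorIndex (TorusSite d L) 2} (hστ : σ ≠ τ)
    (h : ∀ x y : TorusSite d L, (torusGraph d L).Adj x y → τ ≠ flipAt x (flipAt y σ)) :
    xyzBondHamiltonian₃ (d := d) L 1 J₁ J₂ J₃ σ τ = 0 := by
  rw [xyzBondHamiltonian₃, Matrix.neg_apply, Matrix.sum_apply, neg_eq_zero]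
  refine Finset.sum_eq_zero fun e he => ?_
  induction e using Sym2.ind with
  | h x y =>
    have hadj := adj_of_mem_edgeFinset L he
    rw [Sym2.lift_mk]
    show xyzBond₃ 1 J₁ J₂ J₃ x y σ τ = 0
    rw [xyzBond₃_one_apply_of_ne J₁ J₂ J₃ hadj.ne hστ, if_neg (h x y hadj)]

/-- **matrix element of the spin-½ `H'(J₁,J₂,J₃)` on an edge double flip**: `−(J₁ ∓ J₂)/4` (− for parallel, + for antiparallel
spins at the two sites). [folklore] -/
theorem xyzBondHamiltonian₃_one_apply_doubleFlip (J₁ J₂ J₃ : ℝ) {x y : TorusSite d L} (hxy : (torusGraph d L).Adj x y)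
    (σ : TensorIndex (TorusSite d L) 2) :
    xyzBondHamiltonian₃ (d := d) L 1 J₁ J₂ J₃ σ (flipAt x (flipAt y σ)) =
      -(((J₁ - (if σ x = σ y then J₂ else -J₂)) / 4 : ℝ) : ℂ) := by
  have hne : x ≠ y := hxy.ne
  have hστ : σ ≠ flipAt x (flipAt y σ) := by
    intro h
    have := congrFun h x
    rw [flipAt_apply_self, flipAt_apply_of_ne _ hne] at this
    exact fin2_ne_sub (σ x) this
  rw [xyzBondHamiltonian₃, Matrix.neg_apply, Matrix.sum_apply]
  congr 1
  rw [Finset.sum_eq_single (s(x, y))]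
  · rw [Sym2.lift_mk]
    show xyzBond₃ 1 J₁ J₂ J₃ x y σ (flipAt x (flipAt y σ)) = _
    rw [xyzBond₃_one_apply_of_ne J₁ J₂ J₃ hne hστ, if_pos rfl]
  · intro e he hexy
    induction e using Sym2.ind with
    | h x' y' =>
      have hadj := adj_of_mem_edgeFinset L he
      rw [Sym2.lift_mk]
      show xyzBond₃ 1 J₁ J₂ J₃ x' y' σ (flipAt x (flipAt y σ)) = 0
      rw [xyzBond₃_one_apply_of_ne J₁ J₂ J₃ hadj.ne hστ, if_neg]
      intro h
      exact hexy (sym2_eq_of_flipAt_flipAt_eq hne σ h).symm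
  · intro h
    exact absurd ((SimpleGraph.mem_edgeFinset).2 hxy) h

/-- **`H'(J₁,J₂,J₃)` (spin ½) preserves the parity of `Σ_z σ_z`**: its non-zero off-diagonal entries are edge double flips.
[folklore] -/
theorem xyzBondHamiltonian₃_one_apply_of_parity_ne (J₁ J₂ J₃ : ℝ) {σ τ : TensorIndex (TorusSite d L) 2}
    (h : (∑ z, (σ z : ℕ)) % 2 ≠ (∑ z, (τ z : ℕ)) % 2) :
    xyzBondHamiltonian₃ (d := d) L 1 J₁ J₂ J₃ σ τ = 0 := by
  have hστ : σ ≠ τ := fun h' => h (by rw [h'])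
  refine xyzBondHamiltonian₃_one_apply_eq_zero L J₁ J₂ J₃ hστ fun x y _ hτ => h ?_
  rw [hτ, weight_flipAt_flipAt_mod_two]

/-- **entries of `H'(J₁,J₂,J₃)` for `|J₂| ≤ J₁`: real, symmetric, non-positive off the diagonal** (tree
`xyzBondHamiltonian₃_apply`, Björnberg–Ueltschi (A.3)). [folklore] -/
theorem xyzBondHamiltonian₃_entries (n : ℕ) (J₁ J₂ J₃ : ℝ) (hJ : -J₂ ≤ J₁) (hJ' : J₂ ≤ J₁) :
    (∀ σ τ : TensorIndex (TorusSite d L) (n + 1),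
        star (xyzBondHamiltonian₃ (d := d) L n J₁ J₂ J₃ σ τ) = xyzBondHamiltonian₃ (d := d) L n J₁ J₂ J₃ σ τ) ∧
    (∀ σ τ : TensorIndex (TorusSite d L) (n + 1),
        xyzBondHamiltonian₃ (d := d) L n J₁ J₂ J₃ σ τ = xyzBondHamiltonian₃ (d := d) L n J₁ J₂ J₃ τ σ) ∧
    (∀ σ τ : TensorIndex (TorusSite d L) (n + 1), σ ≠ τ → (xyzBondHamiltonian₃ (d := d) L n J₁ J₂ J₃ σ τ).re ≤ 0) := by
  have hreal : ∀ σ τ : TensorIndex (TorusSite d L) (n + 1),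
      star (xyzBondHamiltonian₃ (d := d) L n J₁ J₂ J₃ σ τ) = xyzBondHamiltonian₃ (d := d) L n J₁ J₂ J₃ σ τ :=
    fun σ τ => Complex.conj_eq_iff_im.2 (xyzBondHamiltonian₃_apply L n J₁ J₂ J₃ hJ hJ' σ τ).1
  refine ⟨hreal, fun σ τ => ?_, fun σ τ hστ => (xyzBondHamiltonian₃_apply L n J₁ J₂ J₃ hJ hJ' σ τ).2 hστ⟩
  have h := (xyzBondHamiltonian₃_isHermitian (d := d) L n J₁ J₂ J₃).apply τ σ
  rw [hreal] at h
  exact h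

/-! ### The magnetisation `Sʸ_tot` changes the parity -/

/-- **`Sʸ_tot` (spin ½) flips exactly one spin**: its non-zero entries join configurations of different parity. [folklore] -/
theorem totalSpin_one_one_apply_of_parity_eq {σ τ : Λ → Fin 2} (h : (∑ z, (σ z : ℕ)) % 2 = (∑ z, (τ z : ℕ)) % 2) :
    (totalSpin 1 1 : Op Λ 2) σ τ = 0 := by
  rw [totalSpin, Matrix.sum_apply]
  refine Finset.sum_eq_zero fun x _ => ?_
  have hdiag : ∀ k : Fin 2, spinY 1 k k = 0 := fun k => by
    rw [spinY_one_apply]; rcases fin2_cases k with hk | hk <;> simp [hk]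
  rw [siteSpin, spinVec_one, onSite_apply_offdiag x _ hdiag, if_neg]
  intro hτ
  rw [hτ] at h
  exact weight_flipAt_mod_two x σ h.symm

end TorusEntries

end Summit.HubbardSuperconductivity.HubbardSuperconductivity.Theorems.AnisotropyChord.Transfer
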